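import Summits.Ventures.YMGap.Thresholds.ConnectedThreePointToolsSUN
import Summits.Ventures.YMGap.Thresholds.CouplingDerivativeDim
import HarnessLib

/-!
# Venture YMGap — tools for C-SUS3 / C-DIFF2, EVERY `SU(N)`, EVERY DIMENSION `d ≥ 2`: explicit-constant clustering of the
# strong-coupling state on `ℤ^d` from a one-link modulus (hypothesis-free for `N ≥ 2` at 't Hooft `(d−1)b/N ≤ 1/12`), one split of u₃

HONEST FRAMING: venture file of the cell `pub-ymgap` (QuantumFields programme), seat ds-1 (gen 10).  Strong-coupling
LATTICE statements for `SU(N)` lattice Yang–Mills on `ℤ^d` with the Wilson action at tree coupling `b` inside the one-sided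
vertex-star window fed by a one-link KR modulus (`OneLinkKRModulus N R K`, `2(d−1) b₁/N ≤ R`, `P_d(K b₁/N) < 1`; the Bakry–Émery
modulus `oneLinkKRModulus_SU` discharges it for `N ≥ 2`, `b₁ = N/(12(d−1))`); covariance / cumulant estimates of the unique DLR
state only; nothing about the continuum, confinement at weak coupling, or the Clay problem.  Every-`d` twin of
`ConnectedThreePointToolsSUN` (cumulant algebra, split geometry and bracket bookkeeping are reused from the `d = 4` files).

* `star_limitState_cov_le_of_sep_dim` / ★ `abs_cov_le_of_sep_dim` — EXPLICIT-CONSTANT clustering for the DLR state at any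
  `0 ≤ b ≤ b₁`: base points `≥ m` apart ⇒ `|Cov_μ(F₁, F₂)| ≤ 4(2√N)² e^{−κ(m−2)} (#Λ₁K₁)(#Λ₂K₂)`, ONE rate
  `κ = κ_d(R_G^{(d)}(K b₁/N))` (ds-1 g5's `StarDimLimit.star_limitState_clustering` hides the constant behind `∃ c₁`);
* `plaquetteObs_data_dim`, `bracket_plaquette_le_gen`, `bracket_cylinder_le_gen` — bookkeeping with the `SU(N)` plaquette
  Lipschitz constant `w = 4N³`;
* ★ `abs_threePoint_le_of_sep_dim` — ONE Dobrushin–Shlosman split of `u₃(X; Y; Z)` with `Z` isolated.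

References (mechanism only): R. L. Dobrushin, S. B. Shlosman (1985/87); H. Shen, R. Zhu, X. Zhu, CMP 400 (2023) Lemma 4.1.
-/

noncomputable section

open MeasureTheory ProbabilityTheory Function Finset Filter Topology Real Set
open scoped NNReal
open Literature.Probability.LatticeModels (Torus.proj Torus.proj_apply HasUniqueGibbsMeasure)
open Literature.MathematicalPhysics.QuantumLattice (LGConfig ZdEdge ZdPlaquette plaquetteEdges torusLift torusEdge
  toTorusObservable fundamentalRep fundamentalRep_mem_unitaryGroup continuous_fundamentalRep ymSpecification
  ymGibbsMeasures infiniteVolumeLimitPoints IsInfiniteVolumeLimitAlong infiniteVolumeLimitPoints_nonempty_holds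
  mem_ymGibbsMeasures_of_mem_infiniteVolumeLimitPoints_holds)
open Literature.MathematicalPhysics.QuantumFieldTheory hiding ZdEdge
open Literature.MathematicalPhysics.QuantumFieldTheory.Balaban1983to89.StrongCouplingTorusWindow
open Literature.MathematicalPhysics.QuantumFieldTheory.Balaban1983to89.StrongCouplingDobrushinWindow (OneLinkKRModulus)
open Literature.MathematicalPhysics.QuantumFieldTheory.Balaban1983to89.StrongCouplingKernelWindow (oneLinkKRModulus_SU)
open Summit.Ventures.YMGap.DSWindow (linkEnds vertexStar starWin IsLinkWindowContraction)
open Summit.Ventures.YMGap.StarResolventDim (gaugeR doorPoly)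
open Summit.Ventures.YMGap.StarLemmaG (gaugeR_nonneg)
open Summit.Ventures.YMGap.StarLimit (continuous_of_isLipschitzCylinder abs_cov_le_of_eventually_torus
  linkObs_toTorusObservable)
open Summit.Ventures.YMGap.RobustBall (l1)
open Summit.Ventures.YMGap.PlaquetteSusceptibility (l1_le_mul_norm)
open Summit.Ventures.YMGap.StarDimLimit (star_torus_cov_lipschitz)

namespace Summit.Ventures.YMGap.CouplingResponse

variable {d N : ℕ}

/-- Local shorthand: the any-`d` Dobrushin–Shlosman rate `κ_d(R_G^{(d)}(c)) = (1 − ρ)²/(2(2ρ·2d + 1))`, `ρ = R_G^{(d)}(c)`. -/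
local notation3 (prettyPrint := false) "dimκ(" d' ", " c ")" =>
  (1 - gaugeR d' c) ^ 2 / (2 * (2 * gaugeR d' c * ((2 * d' : ℕ) : ℝ) + 1))

/-! ### §1 Explicit-constant clustering, `SU(N)` -/

section Clustering

/-- **Explicit-constant clustering for infinite-volume limit states, `SU(N)`** (`ℤ^d`, tree coupling `b`): if every
torus of side `L ≥ L₁` carries a vertex-indexed influence array for the star windows (four clauses, one `ρ < 1`), then
for every limit state `μ` and all Lipschitz cylinders `F₁, F₂` whose base points are pairwise `≥ m` apart:
`|Cov_μ(F₁, F₂)| ≤ 4(2√N)² e^{−κ_d(ρ)(m−2)} (#Λ₁K₁)(#Λ₂K₂)` — the torus door `StarDimLimit.star_torus_cov_lipschitz` on the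
defining subsequence passed to the weak limit.  Same proof as `StarDimLimit.star_limitState_clustering`, constant kept. -/
theorem star_limitState_cov_le_of_sep_dim (b : ℝ) {ρ : ℝ} (hρ0 : 0 ≤ ρ) (hρ1 : ρ < 1) (L₁ : ℕ)
    (hW : ∀ (L : ℕ) [NeZero L], L₁ ≤ L → ∃ Kw : Site d L → Edge d L → Edge d L → ℝ,
      (∀ s y x, 0 ≤ Kw s y x) ∧ (∀ s y x, Kw s y x ≠ 0 → ∀ w ∈ linkEnds y, torusNorm (s - w) ≤ 1) ∧
      IsLinkWindowContraction (d := d) (L := L) (wilsonPlaqWeight N b) suFrobDist starWin (fun c => Kw c.1) ∧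
      ∀ (s : Site d L) (x : Edge d L), x ∈ vertexStar s → ∑ y, Kw s y x ≤ ρ)
    {μ : Measure (LGConfig d (Matrix.specialUnitaryGroup (Fin N) ℂ))}
    (hμ : μ ∈ infiniteVolumeLimitPoints (d := d) (fundamentalRep (Fin N)) b)
    {F₁ F₂ : LGConfig d (Matrix.specialUnitaryGroup (Fin N) ℂ) → ℝ} {Λ₁ Λ₂ : Finset (ZdEdge d)} {K₁ K₂ : ℝ≥0}
    (hF₁ : IsLipschitzCylinder (fundamentalRep (Fin N)) F₁ Λ₁ K₁)
    (hF₂ : IsLipschitzCylinder (fundamentalRep (Fin N)) F₂ Λ₂ K₂) {m : ℕ}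
    (hgeom : ∀ a ∈ Λ₁, ∀ b' ∈ Λ₂, (m : ℝ) ≤ ‖a.1 - b'.1‖) :
    |cov[F₁, F₂; μ]| ≤ 4 * (2 * Real.sqrt N) ^ 2 * Real.exp (-((1 - ρ) ^ 2 / (2 * (2 * ρ * ((2 * d : ℕ) : ℝ) + 1)) * ((m - 2 : ℕ) : ℝ))) *
      ((Λ₁.card : ℝ) * K₁) * ((Λ₂.card : ℝ) * K₂) := by
  classical
  haveI : SecondCountableTopology (Matrix (Fin N) (Fin N) ℂ) :=
    inferInstanceAs (SecondCountableTopology (Fin N → Fin N → ℂ))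
  haveI : SecondCountableTopology (Matrix.specialUnitaryGroup (Fin N) ℂ) :=
    Topology.IsEmbedding.subtypeVal.secondCountableTopology
  obtain ⟨Lseq, hLmono, hμL⟩ := hμ
  haveI := hμL.1
  set Dmax : ℕ := ((Λ₁ ∪ Λ₂) ×ˢ (Λ₁ ∪ Λ₂)).sup fun ab =>
    Literature.Probability.LatticeModels.Site.supNorm (ab.1.1 - ab.2.1) with hDmax
  have hDm : ∀ a ∈ Λ₁ ∪ Λ₂, ∀ b' ∈ Λ₁ ∪ Λ₂,
      Literature.Probability.LatticeModels.Site.supNorm (a.1 - b'.1) ≤ Dmax := fun a ha b' hb =>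
    Finset.le_sup (f := fun ab : ZdEdge d × ZdEdge d =>
      Literature.Probability.LatticeModels.Site.supNorm (ab.1.1 - ab.2.1)) (Finset.mk_mem_product ha hb)
  refine abs_cov_le_of_eventually_torus (fundamentalRep (Fin N)) hμL
    (continuous_of_isLipschitzCylinder hF₁) (continuous_of_isLipschitzCylinder hF₂) hF₁.measurable
    hF₂.measurable hF₁.isCylinder hF₂.isCylinder (fun U => hF₁.abs_le U) (fun U => hF₂.abs_le U) ?_
  filter_upwards [eventually_ge_atTop (max L₁ (2 * Dmax))] with k hk
  have hkL : max L₁ (2 * Dmax) ≤ Lseq k := hk.trans hLmono.le_apply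
  obtain ⟨Kw, hKw, hKloc, hH1, hsum⟩ := hW (Lseq k + 1) (by omega)
  have hiso : ∀ a ∈ Λ₁ ∪ Λ₂, ∀ b' ∈ Λ₁ ∪ Λ₂,
      torusNorm ((torusEdge (Lseq k + 1) a).1 - (torusEdge (Lseq k + 1) b').1) =
        Literature.Probability.LatticeModels.Site.supNorm (a.1 - b'.1) := by
    intro a ha b' hb
    have hlt : 2 * Literature.Probability.LatticeModels.Site.supNorm (a.1 - b'.1) < Lseq k + 1 := by
      have := hDm a ha b' hb; omega
    have e : (torusEdge (Lseq k + 1) a).1 - (torusEdge (Lseq k + 1) b').1 =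
        Torus.proj (Lseq k + 1) (a.1 - b'.1) := by
      show Torus.proj (Lseq k + 1) a.1 - Torus.proj (Lseq k + 1) b'.1 = _
      rw [sub_eq_add_neg, ← torusProj_neg_zd, ← torusProj_add_zd, ← sub_eq_add_neg]
    rw [e]
    exact torusNorm_proj_eq hlt
  have hinj : ∀ a ∈ Λ₁ ∪ Λ₂, ∀ b' ∈ Λ₁ ∪ Λ₂,
      torusEdge (Lseq k + 1) a = torusEdge (Lseq k + 1) b' → a = b' := by
    intro a ha b' hb hab
    have h1 : (torusEdge (Lseq k + 1) a).1 = (torusEdge (Lseq k + 1) b').1 := by rw [hab]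
    have h2 : a.2 = b'.2 := by
      have := congrArg Prod.snd hab; exact this
    have h0 : Literature.Probability.LatticeModels.Site.supNorm (a.1 - b'.1) = 0 := by
      rw [← hiso a ha b' hb, h1, sub_self, torusNorm_zero]
    have h3 : a.1 = b'.1 :=
      sub_eq_zero.1 (Literature.Probability.LatticeModels.Site.supNorm_eq_zero_iff.1 h0)
    exact Prod.ext h3 h2
  have hinj₁ : ∀ e ∈ Λ₁, ∀ e' ∈ Λ₁, torusEdge (Lseq k + 1) e = torusEdge (Lseq k + 1) e' → e = e' :=
    fun e he e' he' => hinj e (Finset.mem_union_left _ he) e' (Finset.mem_union_left _ he')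
  have hinj₂ : ∀ e ∈ Λ₂, ∀ e' ∈ Λ₂, torusEdge (Lseq k + 1) e = torusEdge (Lseq k + 1) e' → e = e' :=
    fun e he e' he' => hinj e (Finset.mem_union_right _ he) e' (Finset.mem_union_right _ he')
  have hgeom' : ∀ a ∈ Λ₁, ∀ b' ∈ Λ₂,
      m ≤ torusNorm ((torusEdge (Lseq k + 1) a).1 - (torusEdge (Lseq k + 1) b').1) := by
    intro a ha b' hb
    rw [hiso a (Finset.mem_union_left _ ha) b' (Finset.mem_union_right _ hb)]
    have h := hgeom a ha b' hb
    rw [Literature.Probability.LatticeModels.Site.norm_eq_supNorm] at h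
    exact_mod_cast h
  have h := star_torus_cov_lipschitz (L := Lseq k + 1) b hρ0 hρ1 hKw hKloc hH1 hsum hF₁ hF₂ hinj₁ hinj₂ hgeom'
  have hcov : cov[toTorusObservable (Lseq k + 1) F₁, toTorusObservable (Lseq k + 1) F₂;
      wilsonMeasure (d := d) (L := Lseq k + 1) (fundamentalRep (Fin N)) b] =
      (∫ V, toTorusObservable (Lseq k + 1) F₁ V * toTorusObservable (Lseq k + 1) F₂ V
          ∂(wilsonMeasure (d := d) (L := Lseq k + 1) (fundamentalRep (Fin N)) b)) -
        (∫ V, toTorusObservable (Lseq k + 1) F₁ V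
          ∂(wilsonMeasure (d := d) (L := Lseq k + 1) (fundamentalRep (Fin N)) b)) *
          ∫ V, toTorusObservable (Lseq k + 1) F₂ V
            ∂(wilsonMeasure (d := d) (L := Lseq k + 1) (fundamentalRep (Fin N)) b) := by
    haveI : IsProbabilityMeasure (wilsonMeasure (d := d) (L := Lseq k + 1) (fundamentalRep (Fin N)) b) :=
      isProbabilityMeasure_wilsonMeasure (d := d) (L := Lseq k + 1) _ (continuous_fundamentalRep (Fin N)) _
    have hfo := linkObs_toTorusObservable (L := Lseq k + 1) hF₁ hinj₁
    have hgo := linkObs_toTorusObservable (L := Lseq k + 1) hF₂ hinj₂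
    obtain ⟨B₁, hB₁⟩ := hfo.bounded
    obtain ⟨B₂, hB₂⟩ := hgo.bounded
    have l₁ : MemLp (toTorusObservable (Lseq k + 1) F₁) 2
        (wilsonMeasure (d := d) (L := Lseq k + 1) (fundamentalRep (Fin N)) b) :=
      memLp_of_bounded (a := -B₁) (b := B₁) (ae_of_all _ fun U => abs_le.1 (hB₁ U))
        hfo.measurable.aestronglyMeasurable 2
    have l₂ : MemLp (toTorusObservable (Lseq k + 1) F₂) 2
        (wilsonMeasure (d := d) (L := Lseq k + 1) (fundamentalRep (Fin N)) b) :=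
      memLp_of_bounded (a := -B₂) (b := B₂) (ae_of_all _ fun U => abs_le.1 (hB₂ U))
        hgo.measurable.aestronglyMeasurable 2
    exact covariance_eq_sub l₁ l₂
  rw [← hcov]
  exact h

/-- ★ **Explicit-constant clustering for THE `SU(N)` DLR state on the modulus window** (`ℤ^d`): for a one-link KR
modulus with `2(d−1) b₁/N ≤ R`, `P_d(K b₁/N) < 1`, every `0 ≤ b ≤ b₁`, the DLR state `μ` at `b` (unique, hence a limit point),
and all Lipschitz cylinders `F₁, F₂` whose base points are pairwise `≥ m` apart:
`|Cov_μ(F₁, F₂)| ≤ 4(2√N)² e^{−κ(m−2)} (#Λ₁K₁)(#Λ₂K₂)`, ONE rate `κ = κ_d(R_G^{(d)}(K b₁/N))` on the whole window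
(`star_window_uniform_dim`). -/
theorem abs_cov_le_of_sep_dim (hd : 2 ≤ d) (hN : 1 ≤ N) {R K b₁ : ℝ} (hK0 : 0 ≤ K)
    (hmod : OneLinkKRModulus N R K) (hR : b₁ / N * (2 * ((d : ℝ) - 1)) ≤ R) (hdoor : doorPoly d (K * (b₁ / N)) < 1) {b : ℝ} (h0 : 0 ≤ b) (hb : b ≤ b₁)
    {μ : Measure (LGConfig d (Matrix.specialUnitaryGroup (Fin N) ℂ))}
    (hμ : μ ∈ ymGibbsMeasures (d := d) (fundamentalRep (Fin N)) b)
    {F₁ F₂ : LGConfig d (Matrix.specialUnitaryGroup (Fin N) ℂ) → ℝ} {Λ₁ Λ₂ : Finset (ZdEdge d)} {K₁ K₂ : ℝ≥0}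
    (hF₁ : IsLipschitzCylinder (fundamentalRep (Fin N)) F₁ Λ₁ K₁)
    (hF₂ : IsLipschitzCylinder (fundamentalRep (Fin N)) F₂ Λ₂ K₂) {m : ℕ}
    (hgeom : ∀ a ∈ Λ₁, ∀ b' ∈ Λ₂, (m : ℝ) ≤ ‖a.1 - b'.1‖) :
    |cov[F₁, F₂; μ]| ≤ 4 * (2 * Real.sqrt N) ^ 2 *
      Real.exp (-(dimκ(d, K * (b₁ / N)) * ((m - 2 : ℕ) : ℝ))) *
      ((Λ₁.card : ℝ) * K₁) * ((Λ₂.card : ℝ) * K₂) := by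
  haveI : SecondCountableTopology (Matrix (Fin N) (Fin N) ℂ) :=
    inferInstanceAs (SecondCountableTopology (Fin N → Fin N → ℂ))
  haveI : SecondCountableTopology (Matrix.specialUnitaryGroup (Fin N) ℂ) :=
    Topology.IsEmbedding.subtypeVal.secondCountableTopology
  have hN0 : (0 : ℝ) < N := by exact_mod_cast (show 0 < N by omega)
  have hb₁N : 0 ≤ b₁ / N := div_nonneg (h0.trans hb) hN0.le
  obtain ⟨hρ0, hρ1⟩ := gaugeR_dim_coef_lt_one (N := N) hd hK0 hb₁N hdoor
  have hρc := continuous_fundamentalRep (Fin N)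
  have hu := hasUniqueGibbsMeasure_of_modulus_dim hd hN hK0 hmod hR hdoor h0 hb
  obtain ⟨ν, hν⟩ := infiniteVolumeLimitPoints_nonempty_holds (d := d) (fundamentalRep (Fin N)) hρc b
  have hνG : ν ∈ ymGibbsMeasures (d := d) (fundamentalRep (Fin N)) b :=
    mem_ymGibbsMeasures_of_mem_infiniteVolumeLimitPoints_holds (d := d) (fundamentalRep (Fin N)) hρc hν
  have hμν : μ = ν := hu.1 hμ hνG
  subst hμν
  exact star_limitState_cov_le_of_sep_dim b hρ0 hρ1 3
    (fun L _ hL => star_window_uniform_dim hd hL hN hK0 hmod hR hdoor h0 hb) hν hF₁ hF₂ hgeom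

end Clustering

/-! ### §2 Bookkeeping with the `SU(N)` plaquette constant `w = 4N³` -/

section Bookkeeping

/-- Local shorthand: the normalised plaquette observable `W_q = (1/N) Re tr U_q` of `SU(N)` on `ℤ^d`. -/
local notation3 (prettyPrint := false) "W∗" q:max =>
  zdPlaquetteObs (d := d) (fundamentalRep (Fin N)) (Prod.fst q) (Prod.snd q).1.1 (Prod.snd q).1.2

/-- `W_q` is a Lipschitz cylinder on the four links of `q` (constant `4N³`), measurable, `|W_q| ≤ 1`, links based within
`1` of `x_q`, at most `4` of them. [folklore] -/
theorem plaquetteObs_data_dim (q : ZdPlaquette d) :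
    IsLipschitzCylinder (fundamentalRep (Fin N)) (W∗ q) (plaquetteEdges q) (4 * (N : ℝ≥0) ^ 3) ∧
      Measurable (W∗ q) ∧ (∀ U, |(W∗ q) U| ≤ ((1 : ℝ≥0) : ℝ)) ∧
      (∀ e ∈ plaquetteEdges q, ‖e.1 - q.1‖ ≤ ((1 : ℕ) : ℝ)) ∧ ((plaquetteEdges q).card : ℝ) ≤ 4 := by
  have h := isLipschitzCylinder_zdPlaquetteObs (N := N) (d := d) q.1 q.2.2
  have hρu : ∀ g, fundamentalRep (Fin N) g ∈ Matrix.unitaryGroup (Fin N) ℂ := fundamentalRep_mem_unitaryGroup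
  refine ⟨h, h.measurable, fun U => ?_, fun e he => ?_, ?_⟩
  · simpa using abs_zdPlaquetteObs_le hρu q.1 q.2.1.1 q.2.1.2 U
  · simpa using norm_fst_sub_le_of_mem_plaquetteEdges he
  · exact_mod_cast card_plaquetteEdges_le q



/-- The links of the plaquette `q` of `ℤ^d` are based within `‖x_q − x₀‖_∞ + 1` of any `x₀`. [folklore] -/
theorem plaquetteEdges_norm_sub_le_dim (q : ZdPlaquette d) (x₀ : Literature.Probability.LatticeModels.Site d) :
    ∀ e ∈ plaquetteEdges q,
      ‖e.1 - x₀‖ ≤ ((Literature.Probability.LatticeModels.Site.supNorm (q.1 - x₀) + 1 : ℕ) : ℝ) := by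
  intro e he
  have h1 : ‖e.1 - q.1‖ ≤ 1 := norm_fst_sub_le_of_mem_plaquetteEdges he
  have h2 : ‖q.1 - x₀‖ = Literature.Probability.LatticeModels.Site.supNorm (q.1 - x₀) :=
    Literature.Probability.LatticeModels.Site.norm_eq_supNorm _
  calc ‖e.1 - x₀‖ = ‖(e.1 - q.1) + (q.1 - x₀)‖ := by congr 1; abel
    _ ≤ ‖e.1 - q.1‖ + ‖q.1 - x₀‖ := norm_add_le _ _
    _ ≤ _ := by push_cast; linarith

/-- Supports within `D₁` resp. `D₂` of `x₀` are jointly within `max D₁ D₂` (`ℤ^d`). [folklore] -/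
theorem union_norm_sub_le_dim [DecidableEq (ZdEdge d)] {Λ₁ Λ₂ : Finset (ZdEdge d)}
    {x₀ : Literature.Probability.LatticeModels.Site d} {D₁ D₂ : ℕ}
    (h₁ : ∀ e ∈ Λ₁, ‖e.1 - x₀‖ ≤ D₁) (h₂ : ∀ e ∈ Λ₂, ‖e.1 - x₀‖ ≤ D₂) :
    ∀ e ∈ Λ₁ ∪ Λ₂, ‖e.1 - x₀‖ ≤ ((max D₁ D₂ : ℕ) : ℝ) := by
  intro e he
  rcases Finset.mem_union.1 he with h | h
  · exact (h₁ e h).trans (by exact_mod_cast le_max_left _ _)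
  · exact (h₂ e h).trans (by exact_mod_cast le_max_right _ _)

/-- Supports near two centres are separated by the distance of the centres minus the radii (`ℤ^d`). [folklore] -/
theorem sep_of_near_dim {S₁ S₂ : Finset (ZdEdge d)} {y₁ y₂ : Literature.Probability.LatticeModels.Site d}
    {D₁ D₂ : ℕ} (h₁ : ∀ e ∈ S₁, ‖e.1 - y₁‖ ≤ D₁) (h₂ : ∀ e ∈ S₂, ‖e.1 - y₂‖ ≤ D₂) {m : ℕ}
    (hm : m ≤ Literature.Probability.LatticeModels.Site.supNorm (y₁ - y₂) - (D₁ + D₂)) :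
    ∀ a ∈ S₁, ∀ b ∈ S₂, (m : ℝ) ≤ ‖a.1 - b.1‖ := by
  intro a ha b hb
  have h := norm_sub_sub_le_norm_sub (h₁ a ha) (h₂ b hb)
  rw [Literature.Probability.LatticeModels.Site.norm_eq_supNorm] at h
  rcases le_or_gt (D₁ + D₂) (Literature.Probability.LatticeModels.Site.supNorm (y₁ - y₂)) with hle | hlt
  · have hm' : (m : ℝ) ≤ (Literature.Probability.LatticeModels.Site.supNorm (y₁ - y₂) : ℝ) - (D₁ + D₂) := by
      have := (Nat.cast_le (α := ℝ)).2 hm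
      rw [Nat.cast_sub hle] at this
      push_cast at this
      exact this
    linarith
  · have hm0 : m = 0 := by omega
    rw [hm0, Nat.cast_zero]
    exact norm_nonneg _

/-- `e^{−(κ/4)·‖z‖_∞} ≤ (e^{−κ/(4d)})^{‖z‖₁}` on `ℤ^d` (`‖z‖₁ ≤ d‖z‖_∞`). [folklore] -/
theorem exp_neg_quarter_supNorm_le_pow_dim {κ : ℝ} (hκ : 0 ≤ κ) (hd : 1 ≤ d)
    (z : Literature.Probability.LatticeModels.Site d) :
    Real.exp (-(κ / 4 * ‖z‖)) ≤ Real.exp (-(κ / (4 * d))) ^ l1 z := by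
  rw [← Real.exp_nat_mul]
  refine Real.exp_le_exp.2 ?_
  have h := l1_le_mul_norm (d := d) z
  have hd0 : (0 : ℝ) < d := by exact_mod_cast (show 0 < d by omega)
  have h1 : κ / (4 * d) * (l1 z : ℝ) ≤ κ / (4 * d) * (d * ‖z‖) := mul_le_mul_of_nonneg_left h (by positivity)
  have h2 : κ / (4 * d) * (d * ‖z‖) = κ / 4 * ‖z‖ := by field_simp
  nlinarith

/-- ★ **One Dobrushin–Shlosman split of the connected three-point function, `SU(N)` on `ℤ^d`**: under the modulus hypotheses,
for the DLR state `μ` at `0 ≤ b ≤ b₁` and Lipschitz cylinders `X` (`Λ₁`, `K₁`, `|X| ≤ M₁`), `Y` (`Λ₂`, `K₂`, `|Y| ≤ M₂`),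
`Z` (`Λ₃`, `K₃`) with all base points of `Λ₁ ∪ Λ₂` at sup-distance `≥ m` from those of `Λ₃`:
`|u₃(X; Y; Z)| ≤ 4(2√N)² e^{−κ(m−2)} ((#Λ₁+#Λ₂)(M₁K₂ + M₂K₁) + M₁#Λ₂K₂ + M₂#Λ₁K₁) #Λ₃K₃`. -/
theorem abs_threePoint_le_of_sep_dim (hd : 2 ≤ d) (hN : 1 ≤ N) {R K b₁ : ℝ} (hK0 : 0 ≤ K)
    (hmod : OneLinkKRModulus N R K) (hR : b₁ / N * (2 * ((d : ℝ) - 1)) ≤ R) (hdoor : doorPoly d (K * (b₁ / N)) < 1) {b : ℝ} (h0 : 0 ≤ b) (hb : b ≤ b₁)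
    {μ : Measure (LGConfig d (Matrix.specialUnitaryGroup (Fin N) ℂ))}
    (hμ : μ ∈ ymGibbsMeasures (d := d) (fundamentalRep (Fin N)) b)
    {X Y Z : LGConfig d (Matrix.specialUnitaryGroup (Fin N) ℂ) → ℝ} {Λ₁ Λ₂ Λ₃ : Finset (ZdEdge d)}
    {K₁ K₂ K₃ M₁ M₂ : ℝ≥0}
    (hX : IsLipschitzCylinder (fundamentalRep (Fin N)) X Λ₁ K₁)
    (hY : IsLipschitzCylinder (fundamentalRep (Fin N)) Y Λ₂ K₂)
    (hZ : IsLipschitzCylinder (fundamentalRep (Fin N)) Z Λ₃ K₃)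
    (hM₁ : ∀ U, |X U| ≤ M₁) (hM₂ : ∀ U, |Y U| ≤ M₂) {m : ℕ}
    (h13 : ∀ a ∈ Λ₁, ∀ b' ∈ Λ₃, (m : ℝ) ≤ ‖a.1 - b'.1‖) (h23 : ∀ a ∈ Λ₂, ∀ b' ∈ Λ₃, (m : ℝ) ≤ ‖a.1 - b'.1‖) :
    |cov[fun U => X U * Y U, Z; μ] - (∫ U, X U ∂μ) * cov[Y, Z; μ] - (∫ U, Y U ∂μ) * cov[X, Z; μ]| ≤
      4 * (2 * Real.sqrt N) ^ 2 * Real.exp (-(dimκ(d, K * (b₁ / N)) * ((m - 2 : ℕ) : ℝ))) *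
        ((((Λ₁.card : ℝ) + Λ₂.card) * ((M₁ : ℝ) * K₂ + M₂ * K₁) + M₁ * (Λ₂.card * K₂) + M₂ * (Λ₁.card * K₁)) *
          ((Λ₃.card : ℝ) * K₃)) := by
  classical
  haveI : IsProbabilityMeasure μ := hμ.1
  have hXY := isLipschitzCylinder_mul hX hY hM₁ hM₂
  have hU : ∀ a ∈ Λ₁ ∪ Λ₂, ∀ b' ∈ Λ₃, (m : ℝ) ≤ ‖a.1 - b'.1‖ := fun a ha b' hb' => by
    rcases Finset.mem_union.1 ha with h | h
    · exact h13 a h b' hb'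
    · exact h23 a h b' hb'
  have c1 := abs_cov_le_of_sep_dim hd hN hK0 hmod hR hdoor h0 hb hμ hXY hZ hU
  have c2 := abs_cov_le_of_sep_dim hd hN hK0 hmod hR hdoor h0 hb hμ hY hZ h23
  have c3 := abs_cov_le_of_sep_dim hd hN hK0 hmod hR hdoor h0 hb hμ hX hZ h13
  refine (abs_threePoint_le hM₁ hM₂).trans ?_
  set E : ℝ := 4 * (2 * Real.sqrt N) ^ 2 *
    Real.exp (-(dimκ(d, K * (b₁ / N)) * ((m - 2 : ℕ) : ℝ))) with hE
  have hE0 : 0 ≤ E := by positivity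
  have hcard : ((Λ₁ ∪ Λ₂).card : ℝ) ≤ (Λ₁.card : ℝ) + Λ₂.card := by exact_mod_cast Finset.card_union_le _ _
  have hK₃ : 0 ≤ (Λ₃.card : ℝ) * K₃ := by positivity
  have hc1 : |cov[fun U => X U * Y U, Z; μ]| ≤
      E * (((Λ₁.card : ℝ) + Λ₂.card) * ((M₁ : ℝ) * K₂ + M₂ * K₁)) * ((Λ₃.card : ℝ) * K₃) := by
    refine c1.trans ?_
    push_cast
    have : ((Λ₁ ∪ Λ₂).card : ℝ) * ((M₁ : ℝ) * K₂ + M₂ * K₁) ≤ ((Λ₁.card : ℝ) + Λ₂.card) * ((M₁ : ℝ) * K₂ + M₂ * K₁) :=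
      mul_le_mul_of_nonneg_right hcard (by positivity)
    exact mul_le_mul_of_nonneg_right (mul_le_mul_of_nonneg_left this hE0) hK₃
  have hc2 : (M₁ : ℝ) * |cov[Y, Z; μ]| ≤ E * ((M₁ : ℝ) * (Λ₂.card * K₂)) * ((Λ₃.card : ℝ) * K₃) := by
    calc (M₁ : ℝ) * |cov[Y, Z; μ]| ≤ M₁ * (E * ((Λ₂.card : ℝ) * K₂) * ((Λ₃.card : ℝ) * K₃)) :=
          mul_le_mul_of_nonneg_left c2 M₁.2
      _ = _ := by ring
  have hc3 : (M₂ : ℝ) * |cov[X, Z; μ]| ≤ E * ((M₂ : ℝ) * (Λ₁.card * K₁)) * ((Λ₃.card : ℝ) * K₃) := by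
    calc (M₂ : ℝ) * |cov[X, Z; μ]| ≤ M₂ * (E * ((Λ₁.card : ℝ) * K₁) * ((Λ₃.card : ℝ) * K₃)) :=
          mul_le_mul_of_nonneg_left c3 M₂.2
      _ = _ := by ring
  calc _ ≤ _ := add_le_add (add_le_add hc1 hc2) hc3
    _ = _ := by ring

end Bookkeeping

end Summit.Ventures.YMGap.CouplingResponse

end
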